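import Mathlib
import Summits.Ventures.PercRepro2.Defs
import Summits.Ventures.PercRepro2.Independence
import Summits.Ventures.PercRepro2.Harris
import Summits.Ventures.PercRepro2.Graph
import Summits.Ventures.PercRepro2.Exploration
import Summits.Ventures.PercRepro2.Events
import Summits.Ventures.PercRepro2.FourFunctions
import Summits.Ventures.PercRepro2.Induced
import Summits.Ventures.PercRepro2.Frontier
import Summits.Ventures.PercRepro2.ObsIndependence
import Summits.Ventures.PercRepro2.BHK
import Summits.Ventures.PercRepro2.BHKEvents
import Summits.Ventures.PercRepro2.OrderPreservation
import Summits.Ventures.PercRepro2.OrderPreservationDual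

/-!
# (Yu1), part 1: the cluster functionals `u`, `β`, `q` (blind cell PercRepro2, typer-1)

Light-first exploration of `S = C(a₁)`: the explored cluster `W` is scored by the heavy root's
functionals `u(W) = P_{G∖W}(a₃ ∉ C(a₂))` (increasing in `W`), `β(W) = P_{G∖W}(b ∈ C(a₂))`
(decreasing) and `q(W) = P_{G∖W}(b ∈ C(a₂), a₃ ∉ C(a₂))`, all instances of `delClusterProb`.

* `delConfig_mono`, `delClusterProb_mono` (down-set families give increasing `g`, mirror of
  `delClusterProb_anti`), `delClusterProb_compl`, and **Harris in `G ∖ W`**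
  (`delClusterProb_inter_le`): `g_{𝓤 ∩ 𝓓} ≤ g_𝓓 · g_𝓤`.
* `Yu1.u`, `Yu1.beta`, `Yu1.q`, the indicator functional `Yu1.ind`, their monotonicity / bounds,
  `Yu1.q_le` (step (1) of (Yu1)), `Yu1.one_sub_u`, `Yu1.expect_clusterObs_univ`,
  `Yu1.expect_mul_indicator_eq_zero_of_null`, and the polynomial chain `Yu1.chain_alg`.

Part 2 (`Yu1Events`) holds the event identities, part 3 (`Yu1`) the theorem.
-/

namespace Summit.Ventures.PercRepro2

section Functionals

variable {V : Type*} {E : Type*} [Fintype E] [DecidableEq E] [Fintype V] [DecidableEq V]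
  {R : Type*} [CommRing R] [LinearOrder R] [IsStrictOrderedRing R]

omit [Fintype E] [DecidableEq E] [Fintype V] [DecidableEq V] in
/-- `delConfig` is monotone in the configuration. -/
lemma delConfig_mono {ends : E → Sym2 V} (W : Set V) {ω ω' : Config E} (h : ω ≤ ω') :
    delConfig ends W ω ≤ delConfig ends W ω' := by
  intro e
  by_cases he : e ∈ touches ends W
  · rw [delConfig_apply_of_mem he]
    exact Bool.false_le _
  · rw [delConfig_apply_of_notMem he, delConfig_apply_of_notMem he]
    exact h e

omit [Fintype V] [DecidableEq V] in
/-- For a down-set `𝓥`, `g = delClusterProb` is monotone in `W` (mirror of `delClusterProb_anti`). -/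
lemma delClusterProb_mono (p : E → R) (hp : IsProbVec p) (ends : E → Sym2 V) (t : V)
    {𝓥 : Set (Set V)} (h𝓥 : IsLowerSet 𝓥) : Monotone (delClusterProb p ends t 𝓥) := by
  intro W W' h
  unfold delClusterProb
  refine prob_mono hp fun ω hω => ?_
  exact h𝓥 (cluster_mono (delConfig_anti h ω) t) hω

omit [Fintype V] [DecidableEq V] [LinearOrder R] [IsStrictOrderedRing R] in
/-- `g` of the complementary family is `1 − g`. -/
lemma delClusterProb_compl (p : E → R) (ends : E → Sym2 V) (t : V) (𝓥 : Set (Set V))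
    (W : Set V) : delClusterProb p ends t 𝓥ᶜ W = 1 - delClusterProb p ends t 𝓥 W := by
  unfold delClusterProb
  rw [← prob_compl]
  rfl

omit [Fintype V] [DecidableEq V] in
/-- **Harris in `G ∖ W`**: `g_{𝓤 ∩ 𝓓}(W) ≤ g_𝓓(W) · g_𝓤(W)` for an up-set `𝓤` and a down-set `𝓓`. -/
lemma delClusterProb_inter_le (p : E → R) (hp : IsProbVec p) (ends : E → Sym2 V) (t : V)
    {𝓤 𝓓 : Set (Set V)} (h𝓤 : IsUpperSet 𝓤) (h𝓓 : IsLowerSet 𝓓) (W : Set V) :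
    delClusterProb p ends t (𝓤 ∩ 𝓓) W ≤
      delClusterProb p ends t 𝓓 W * delClusterProb p ends t 𝓤 W := by
  unfold delClusterProb
  have e : {ω | cluster ends (delConfig ends W ω) t ∈ 𝓤 ∩ 𝓓} =
      {ω | cluster ends (delConfig ends W ω) t ∈ 𝓓} ∩
        {ω | cluster ends (delConfig ends W ω) t ∈ 𝓤} := by
    ext ω; simp only [Set.mem_inter_iff, Set.mem_setOf_eq]; tauto
  rw [e]
  refine prob_inter_le_prob_mul_prob_of_isLowerSet hp ?_ ?_
  · intro ω ω' h hω
    exact h𝓓 (cluster_mono (delConfig_mono W h) t) hω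
  · intro ω ω' h hω
    exact h𝓤 (cluster_mono (delConfig_mono W h) t) hω

end Functionals

namespace Yu1

variable {V : Type*} {E : Type*} [Fintype E] [DecidableEq E] [Fintype V] [DecidableEq V]
  {R : Type*} [CommRing R] [LinearOrder R] [IsStrictOrderedRing R]

/-- `u(W) = P_{G∖W}(a₃ ∉ C(a₂))`: the `a₃`-avoidance functional of the heavy root, evaluated on
the explored light cluster `W` (increasing in `W`). -/
noncomputable def u (p : E → R) (ends : E → Sym2 V) (a₂ a₃ : V) : Set V → R :=
  delClusterProb p ends a₂ {W | a₃ ∉ W}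

/-- `β(W) = P_{G∖W}(b ∈ C(a₂))`: the `b`-hitting functional of the heavy root (decreasing). -/
noncomputable def beta (p : E → R) (ends : E → Sym2 V) (a₂ b : V) : Set V → R :=
  delClusterProb p ends a₂ {W | b ∈ W}

/-- `q(W) = P_{G∖W}(b ∈ C(a₂), a₃ ∉ C(a₂))`. -/
noncomputable def q (p : E → R) (ends : E → Sym2 V) (a₂ a₃ b : V) : Set V → R :=
  delClusterProb p ends a₂ ({W | b ∈ W} ∩ {W | a₃ ∉ W})

omit [Fintype E] [DecidableEq E] [Fintype V] [DecidableEq V] [LinearOrder R]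
  [IsStrictOrderedRing R] in
/-- The indicator `1_{v ∈ W}` as a cluster functional. -/
noncomputable def ind (v : V) : Set V → R :=
  {W | v ∈ W}.indicator 1

omit [Fintype V] [DecidableEq V] in
/-- `u` is increasing. -/
lemma u_mono (p : E → R) (hp : IsProbVec p) (ends : E → Sym2 V) (a₂ a₃ : V) :
    Monotone (u p ends a₂ a₃) := by
  unfold u
  exact delClusterProb_mono p hp ends a₂ (isLowerSet_notMem_setOf a₃)

omit [Fintype V] [DecidableEq V] in
/-- `β` is decreasing. -/
lemma beta_anti (p : E → R) (hp : IsProbVec p) (ends : E → Sym2 V) (a₂ b : V) :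
    Antitone (beta p ends a₂ b) := by
  unfold beta
  exact delClusterProb_anti p hp ends a₂ (isUpperSet_mem_setOf b)

omit [Fintype V] [DecidableEq V] in
/-- `0 ≤ u`. -/
lemma u_nonneg (p : E → R) (hp : IsProbVec p) (ends : E → Sym2 V) (a₂ a₃ : V) (W : Set V) :
    0 ≤ u p ends a₂ a₃ W :=
  delClusterProb_nonneg p hp ends a₂ _ W

omit [Fintype V] [DecidableEq V] in
/-- `u ≤ 1`. -/
lemma u_le_one (p : E → R) (hp : IsProbVec p) (ends : E → Sym2 V) (a₂ a₃ : V) (W : Set V) :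
    u p ends a₂ a₃ W ≤ 1 :=
  delClusterProb_le_one p hp ends a₂ _ W

omit [Fintype V] [DecidableEq V] in
/-- `0 ≤ β`. -/
lemma beta_nonneg (p : E → R) (hp : IsProbVec p) (ends : E → Sym2 V) (a₂ b : V) (W : Set V) :
    0 ≤ beta p ends a₂ b W :=
  delClusterProb_nonneg p hp ends a₂ _ W

omit [Fintype V] [DecidableEq V] in
/-- `β ≤ 1`. -/
lemma beta_le_one (p : E → R) (hp : IsProbVec p) (ends : E → Sym2 V) (a₂ b : V) (W : Set V) :
    beta p ends a₂ b W ≤ 1 :=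
  delClusterProb_le_one p hp ends a₂ _ W

omit [Fintype V] [DecidableEq V] in
/-- **Step (1), Harris in `G ∖ W`**: `q(W) ≤ u(W) · β(W)`. -/
lemma q_le (p : E → R) (hp : IsProbVec p) (ends : E → Sym2 V) (a₂ a₃ b : V) (W : Set V) :
    q p ends a₂ a₃ b W ≤ u p ends a₂ a₃ W * beta p ends a₂ b W := by
  unfold q u beta
  exact delClusterProb_inter_le p hp ends a₂ (isUpperSet_mem_setOf b) (isLowerSet_notMem_setOf a₃) W

omit [Fintype V] [DecidableEq V] [LinearOrder R] [IsStrictOrderedRing R] in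
/-- `1 − u = g_{a₃ ∈ ·}`. -/
lemma one_sub_u (p : E → R) (ends : E → Sym2 V) (a₂ a₃ : V) (W : Set V) :
    1 - u p ends a₂ a₃ W = delClusterProb p ends a₂ {W | a₃ ∈ W} W := by
  have e : ({W : Set V | a₃ ∉ W}ᶜ : Set (Set V)) = {W | a₃ ∈ W} := by
    ext W; simp
  unfold u
  rw [← e, delClusterProb_compl]

omit [Fintype E] [DecidableEq E] [Fintype V] [DecidableEq V] in
/-- The indicator functional is increasing. -/
lemma ind_mono (v : V) : Monotone (ind v : Set V → R) := by
  intro W W' h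
  unfold ind
  by_cases hW : v ∈ W
  · simp only [Set.indicator_of_mem (show W ∈ {W : Set V | v ∈ W} from hW),
      Set.indicator_of_mem (show W' ∈ {W : Set V | v ∈ W} from h hW), Pi.one_apply, le_refl]
  · rw [Set.indicator_of_notMem (show W ∉ {W : Set V | v ∈ W} from hW)]
    exact Set.indicator_apply_nonneg fun _ => zero_le_one

omit [Fintype E] [DecidableEq E] [Fintype V] [DecidableEq V] in
/-- `0 ≤ 1_{v ∈ ·}`. -/
lemma ind_nonneg (v : V) (W : Set V) : 0 ≤ (ind v W : R) :=
  Set.indicator_apply_nonneg fun _ => zero_le_one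

omit [DecidableEq V] [LinearOrder R] [IsStrictOrderedRing R] in
/-- Cluster observables on the whole graph. -/
lemma expect_clusterObs_univ (p : E → R) (ends : E → Sym2 V) (s : V) (F : Set V → R)
    (S : Set (Config E)) :
    expect p (clusterObs ends Finset.univ s F * S.indicator 1) =
      expect p (fun ω => F (cluster ends ω s) * S.indicator 1 ω) := by
  congr 1
  funext ω
  simp only [Pi.mul_apply, clusterObs, clusterIn, Finset.coe_univ, induced_univ]

omit [Fintype V] [DecidableEq V] in
/-- Expectations against the indicator of a null event vanish. -/
lemma expect_mul_indicator_eq_zero_of_null {p : E → R} (hp : IsProbVec p)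
    {S : Set (Config E)} (hS : prob p S = 0) (g : Config E → R) :
    expect p (fun ω => g ω * S.indicator 1 ω) = 0 := by
  have hw : ∀ ω ∈ S, weight p ω = 0 := by
    intro ω hω
    have h0 := (Finset.sum_eq_zero_iff_of_nonneg fun ω _ =>
      Set.indicator_apply_nonneg fun _ => weight_nonneg hp ω).1 hS ω (Finset.mem_univ ω)
    rwa [Set.indicator_of_mem hω] at h0
  unfold expect
  refine Finset.sum_eq_zero fun ω _ => ?_
  by_cases hω : ω ∈ S
  · rw [hw ω hω, zero_mul]
  · simp [Set.indicator_of_notMem hω]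

omit [Fintype E] [DecidableEq E] [Fintype V] [DecidableEq V] in
/-- The polynomial chain behind (Yu1): from Harris (`s1`), the two BHK inequalities (`h2`, `h3`)
and the order on `R` (`h4`) to `T · U · P ≤ A · (B − r) · P`. -/
lemma chain_alg {T ABu A B Bb BbU Uu PR Rb : R} (s1 : T ≤ ABu) (h2 : ABu * PR ≤ A * B)
    (h3 : Bb * Uu ≤ BbU * PR) (eRb : Rb = Bb - BbU) (h4 : Bb ≤ B) (hA : 0 ≤ A) (hU : 0 ≤ Uu)
    (hPR : 0 ≤ PR) (hUPR : Uu ≤ PR) : T * Uu * PR ≤ A * (B - Rb) * PR := by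
  have hUU : 0 ≤ Uu * PR := mul_nonneg hU hPR
  have hPU : 0 ≤ PR - Uu := sub_nonneg.2 hUPR
  calc T * Uu * PR = T * (Uu * PR) := by ring
    _ ≤ ABu * (Uu * PR) := mul_le_mul_of_nonneg_right s1 hUU
    _ = (ABu * PR) * Uu := by ring
    _ ≤ (A * B) * Uu := mul_le_mul_of_nonneg_right h2 hU
    _ = A * B * PR - A * B * (PR - Uu) := by ring
    _ ≤ A * B * PR - A * Bb * (PR - Uu) := by
        have := mul_le_mul_of_nonneg_right (mul_le_mul_of_nonneg_left h4 hA) hPU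
        linarith
    _ = A * B * PR - A * (Bb * PR) + A * (Bb * Uu) := by ring
    _ ≤ A * B * PR - A * (Bb * PR) + A * (BbU * PR) := by
        have := mul_le_mul_of_nonneg_left h3 hA
        linarith
    _ = A * (B - Rb) * PR := by rw [eRb]; ring

end Yu1

end Summit.Ventures.PercRepro2
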